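import Literature.Probability.LatticeModels.PolymerPressure
import HarnessLib

/-!
# The centred lift of the discrete torus and its local geometry

Bookkeeping used in every "torus versus infinite lattice" comparison of a thermodynamic limit
(here for the anchored cluster expansion behind the two-point function of the fact
`bgm_two_point_limit`).

RELATION TO EXISTING DECLARATIONS (to be unified by a librarian pass). `Torus.cRep` below is THE
SAME MAP as `Literature.Probability.LatticeModels.Torus.rep` of `SubcriticalFourier.lean`
(`Torus.rep u i = Torus.cRepZ (u i)`, by `rfl`), and `Torus.proj_cRep` is its `Torus.proj_rep`;
likewise `torusGraph_adj_proj_iff_of_mem_box` re-proves `torusGraph_adj_proj_iff` of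
`LroInfraredBound.lean`. Those two files sit on top of the Ising machinery (random currents,
reflection positivity, transfer matrices) whose import closure is not wanted under the cluster
expansion of the Hubbard model, so this light file is meant to become the canonical home:
`Torus.rep` should be turned into an `abbrev` for `Torus.cRep` (and `Torus.proj_rep`,
`Torus.rep_mem_centredCube` re-derived from the lemmas here) once this lands. What is NEW here is
the minimality of the centred representative, the torus sup-norm `tnorm` with its triangle
inequality and the one-Lipschitz property along torus edges, and `cRep ∘ proj = id` on `Λ_M`.
Contents:

* `Torus.cRepZ a` / `Torus.cRep u` — the CENTRED representative `-L < 2r ≤ L` of a residue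
  `a : ZMod L`, resp. coordinatewise of a torus point `u : (ℤ/Lℤ)^d`; `Torus.proj_cRep`
  (it is a section of `Torus.proj`), `Torus.cRep_injective`;
* MINIMALITY `Torus.natAbs_cRepZ_le` (`|cRepZ a| ≤ |z|` for every representative `z` of `a`) and
  `Torus.supNorm_cRep_proj_le` (`‖cRep (proj z)‖_∞ ≤ ‖z‖_∞`);
* the torus sup-"norm" `Torus.tnorm u = ‖cRep u‖_∞` with the triangle inequality `tnorm_add_le`,
  `tnorm_neg`, `tnorm_proj_le`, the **one-Lipschitz property along nearest-neighbour steps**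
  `tnorm_sub_le_succ_of_adj` (the torus distance to any base point changes by at most one along
  an edge of `torusGraph d L`), and `cRep_mem_box_iff` (`cRep u ∈ Λ_M ↔ tnorm u ≤ M`);
* `Torus.proj` is injective on coordinatewise-close pairs (`proj_injective_of_abs_sub_lt`),
  `cRep_proj_of_mem_box` (`cRep (proj x) = x` on `Λ_M` when `2M < L`), and the **local graph
  isomorphism** `torusGraph_adj_proj_iff_of_mem_box`: for `x, y ∈ Λ_M` with `2M + 1 < L`,
  `proj x ∼ proj y` in the torus iff `x ∼ y` in `ℤ^d`.

Everything is PROVED; only definitions `cRepZ`, `cRep`, `tnorm` are introduced.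

## References

* S. Friedli, Y. Velenik, *Statistical Mechanics of Lattice Systems* (CUP 2017), §3.1 (the torus
  `𝕋_L = ℤ^d / Lℤ^d` and its projection). [FriedliVelenik2017]
-/

noncomputable section

namespace Literature.Probability.LatticeModels

open Finset

section Centred

variable {d L : ℕ} [NeZero L]

/-! ### The centred representative of a residue -/

/-- The centred representative of `a : ZMod L`: the integer `r ≡ a` with `-L < 2r ≤ L` (the scalar
form of `Torus.rep` of `SubcriticalFourier.lean`: `Torus.rep u i = Torus.cRepZ (u i)` by `rfl`; to be
unified, see the module docstring). [cite: FriedliVelenik2017, §3.1] -/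
def Torus.cRepZ (a : ZMod L) : ℤ := if 2 * a.val ≤ L then (a.val : ℤ) else (a.val : ℤ) - L

/-- `cRepZ a` represents `a`. [folklore] -/
theorem Torus.intCast_cRepZ (a : ZMod L) : ((Torus.cRepZ a : ℤ) : ZMod L) = a := by
  unfold Torus.cRepZ
  split_ifs
  · rw [Int.cast_natCast, ZMod.natCast_zmod_val]
  · rw [Int.cast_sub, Int.cast_natCast, Int.cast_natCast, ZMod.natCast_zmod_val, ZMod.natCast_self, sub_zero]

/-- The centring window `-L < 2·cRepZ a ≤ L`. [folklore] -/
theorem Torus.two_mul_cRepZ_bounds (a : ZMod L) : -(L : ℤ) < 2 * Torus.cRepZ a ∧ 2 * Torus.cRepZ a ≤ L := by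
  have hv : a.val < L := ZMod.val_lt a
  unfold Torus.cRepZ
  split_ifs with h
  · constructor <;> omega
  · constructor <;> omega

/-- Hence `2|cRepZ a| ≤ L`. [folklore] -/
theorem Torus.two_mul_natAbs_cRepZ_le (a : ZMod L) : 2 * (Torus.cRepZ a).natAbs ≤ L := by
  have h := Torus.two_mul_cRepZ_bounds a
  omega

omit [NeZero L] in
/-- Two representatives of the same residue differ by `0` or by at least `L` in absolute value.
[folklore] -/
theorem Torus.sub_repr_dichotomy {z w : ℤ} (h : (z : ZMod L) = (w : ZMod L)) :
    z = w ∨ (L : ℤ) ≤ |z - w| := by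
  rw [ZMod.intCast_eq_intCast_iff_dvd_sub] at h
  obtain ⟨k, hk⟩ := h
  rcases eq_or_ne k 0 with rfl | hk0
  · left
    rw [mul_zero, sub_eq_zero] at hk
    exact hk.symm
  · right
    have h1 : (1 : ℤ) ≤ |k| := Int.one_le_abs hk0
    have hL : (0 : ℤ) ≤ L := Nat.cast_nonneg L
    calc (L : ℤ) = |(L : ℤ)| * 1 := by rw [abs_of_nonneg hL, mul_one]
      _ ≤ |(L : ℤ)| * |k| := mul_le_mul_of_nonneg_left h1 (abs_nonneg _)
      _ = |w - z| := by rw [← abs_mul, ← hk]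
      _ = |z - w| := abs_sub_comm w z

/-- **Minimality of the centred representative**: `|cRepZ a| ≤ |z|` for every integer `z`
representing `a`. [folklore] -/
theorem Torus.natAbs_cRepZ_le {a : ZMod L} {z : ℤ} (hz : (z : ZMod L) = a) : (Torus.cRepZ a).natAbs ≤ z.natAbs := by
  have hb := Torus.two_mul_cRepZ_bounds a
  rcases Torus.sub_repr_dichotomy (L := L) (z := z) (w := Torus.cRepZ a) (by rw [hz, Torus.intCast_cRepZ]) with h | h
  · rw [h]
  · have h2 : |z - Torus.cRepZ a| ≤ |z| + |Torus.cRepZ a| := abs_sub z _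
    have h3 : 2 * |Torus.cRepZ a| ≤ L := by rw [Int.abs_eq_natAbs]; exact_mod_cast Torus.two_mul_natAbs_cRepZ_le a
    have h4 : |Torus.cRepZ a| ≤ |z| := by linarith
    have h5 : ((Torus.cRepZ a).natAbs : ℤ) ≤ (z.natAbs : ℤ) := by
      rwa [Int.natCast_natAbs, Int.natCast_natAbs]
    exact_mod_cast h5

/-! ### The centred lift of the torus -/

/-- The centred lift `(ℤ/Lℤ)^d → ℤ^d`, coordinatewise centred representatives — the same map as
`Torus.rep` of `SubcriticalFourier.lean` (definitionally; that declaration should become an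
`abbrev` of this one, see the module docstring). [cite: FriedliVelenik2017, §3.1] -/
def Torus.cRep (u : TorusSite d L) : Site d := fun i => Torus.cRepZ (u i)

/-- `cRep` is a section of the projection: `proj (cRep u) = u` (= `Torus.proj_rep` of
`SubcriticalFourier.lean` for the duplicate `Torus.rep`). [folklore] -/
@[simp] theorem Torus.proj_cRep (u : TorusSite d L) : Torus.proj L (Torus.cRep u) = u := by
  funext i
  rw [Torus.proj_apply, Torus.cRep, Torus.intCast_cRepZ]

/-- `cRep` is injective. [folklore] -/
theorem Torus.cRep_injective : Function.Injective (Torus.cRep (d := d) (L := L)) := fun u v h => by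
  rw [← Torus.proj_cRep u, ← Torus.proj_cRep v, h]

/-- **`‖cRep (proj z)‖_∞ ≤ ‖z‖_∞`**: the centred lift of a projected point is no farther from the
origin than the point. [folklore] -/
theorem Torus.supNorm_cRep_proj_le (z : Site d) : Site.supNorm (Torus.cRep (Torus.proj L z)) ≤ Site.supNorm z := by
  rw [Site.supNorm_le_iff]
  intro i
  exact (Torus.natAbs_cRepZ_le (by rw [Torus.proj_apply])).trans (Site.natAbs_le_supNorm z i)

/-- The torus sup-norm: `tnorm u = ‖cRep u‖_∞`, the sup-norm distance from `u` to `0` on the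
torus. [cite: FriedliVelenik2017, §3.1] -/
def Torus.tnorm (u : TorusSite d L) : ℕ := Site.supNorm (Torus.cRep u)

/-- `tnorm (proj z) ≤ ‖z‖_∞`. [folklore] -/
theorem Torus.tnorm_proj_le (z : Site d) : Torus.tnorm (Torus.proj L z) ≤ Site.supNorm z :=
  Torus.supNorm_cRep_proj_le z

/-- **Triangle inequality** for the torus sup-norm. [folklore] -/
theorem Torus.tnorm_add_le (u v : TorusSite d L) : Torus.tnorm (u + v) ≤ Torus.tnorm u + Torus.tnorm v := by
  have h : u + v = Torus.proj L (Torus.cRep u + Torus.cRep v) := by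
    funext i
    simp only [Pi.add_apply, Torus.proj_apply, Int.cast_add]
    rw [show ((Torus.cRep u i : ℤ) : ZMod L) = u i from Torus.intCast_cRepZ (u i),
      show ((Torus.cRep v i : ℤ) : ZMod L) = v i from Torus.intCast_cRepZ (v i)]
  calc Torus.tnorm (u + v) = Torus.tnorm (Torus.proj L (Torus.cRep u + Torus.cRep v)) := by rw [← h]
    _ ≤ Site.supNorm (Torus.cRep u + Torus.cRep v) := Torus.tnorm_proj_le _
    _ ≤ Torus.tnorm u + Torus.tnorm v := Site.supNorm_add_le _ _

/-- The torus sup-norm is invariant under negation. [folklore] -/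
theorem Torus.tnorm_neg_le (u : TorusSite d L) : Torus.tnorm (-u) ≤ Torus.tnorm u := by
  have h : -u = Torus.proj L (-Torus.cRep u) := by
    funext i
    simp only [Pi.neg_apply, Torus.proj_apply, Int.cast_neg]
    rw [show ((Torus.cRep u i : ℤ) : ZMod L) = u i from Torus.intCast_cRepZ (u i)]
  have hneg : Site.supNorm (-Torus.cRep u) = Site.supNorm (Torus.cRep u) := by
    unfold Site.supNorm
    congr 1
    funext i
    rw [Pi.neg_apply, Int.natAbs_neg]
  calc Torus.tnorm (-u) = Torus.tnorm (Torus.proj L (-Torus.cRep u)) := by rw [← h]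
    _ ≤ Site.supNorm (-Torus.cRep u) := Torus.tnorm_proj_le _
    _ = Torus.tnorm u := hneg

/-- A unit vector has torus sup-norm at most one. [folklore] -/
theorem Torus.tnorm_single_le (i : Fin d) : Torus.tnorm (Pi.single i 1 : TorusSite d L) ≤ 1 := by
  have h : (Pi.single i 1 : TorusSite d L) = Torus.proj L (Pi.single i 1) := by
    funext j
    rw [Torus.proj_apply]
    rcases eq_or_ne j i with rfl | hj
    · simp
    · simp [Pi.single_eq_of_ne hj]
  have h1 : Site.supNorm (Pi.single i (1 : ℤ) : Site d) ≤ 1 := by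
    rw [Site.supNorm_le_iff]
    intro j
    rcases eq_or_ne j i with rfl | hj
    · simp
    · simp [Pi.single_eq_of_ne hj]
  rw [h]
  exact (Torus.tnorm_proj_le _).trans h1

/-- **One-Lipschitz along edges**: along a nearest-neighbour step of the torus, the torus distance
to any base point `w` changes by at most one. [cite: FriedliVelenik2017, §3.1] -/
theorem Torus.tnorm_sub_le_succ_of_adj {u v : TorusSite d L} (h : (torusGraph d L).Adj u v) (w : TorusSite d L) :
    Torus.tnorm (v - w) ≤ Torus.tnorm (u - w) + 1 := by
  obtain ⟨-, ⟨i, hi⟩ | ⟨i, hi⟩⟩ := (torusGraph_adj_iff u v).1 h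
  · have e : v - w = (u - w) + Pi.single i 1 := by rw [hi]; abel
    have h1 := Torus.tnorm_add_le (u - w) (Pi.single i 1 : TorusSite d L)
    have h2 := Torus.tnorm_single_le (d := d) (L := L) i
    rw [e]
    omega
  · have e : v - w = (u - w) + -(Pi.single i 1 : TorusSite d L) := by rw [hi]; abel
    have h1 := Torus.tnorm_add_le (u - w) (-(Pi.single i 1 : TorusSite d L))
    have h2 := Torus.tnorm_neg_le (Pi.single i 1 : TorusSite d L)
    have h3 := Torus.tnorm_single_le (d := d) (L := L) i
    rw [e]
    omega

omit [NeZero L] in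
/-- `cRep u ∈ Λ_M ↔ tnorm u ≤ M`. [folklore] -/
theorem Torus.cRep_mem_box_iff {u : TorusSite d L} {M : ℕ} : Torus.cRep u ∈ box d M ↔ Torus.tnorm u ≤ M :=
  mem_box_iff_supNorm_le

/-! ### `Torus.proj` near the centred box: injectivity and the local graph isomorphism -/

omit [NeZero L] in
/-- `Torus.proj` is injective on pairs whose coordinates differ by less than `L`. [folklore] -/
theorem Torus.proj_injective_of_abs_sub_lt {x y : Site d} (hxy : ∀ j, |x j - y j| < L)
    (h : Torus.proj L x = Torus.proj L y) : x = y := by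
  funext j
  have hj : ((x j : ℤ) : ZMod L) = ((y j : ℤ) : ZMod L) := by
    have := congrFun h j
    rwa [Torus.proj_apply, Torus.proj_apply] at this
  rcases Torus.sub_repr_dichotomy (L := L) hj with h' | h'
  · exact h'
  · exact absurd (hxy j) (not_lt.2 h')

omit [NeZero L] in
/-- Coordinates of differences of points of `Λ_M` are at most `2M` in absolute value (a private
copy of `abs_sub_le_of_mem_box` of `LroInfraredBound.lean`, not imported here). [folklore] -/
private theorem abs_sub_le_two_mul_of_mem_box {M : ℕ} {x y : Site d} (hx : x ∈ box d M) (hy : y ∈ box d M)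
    (j : Fin d) : |x j - y j| ≤ 2 * M := by
  rw [mem_box] at hx hy
  rw [abs_le]
  constructor <;> linarith [(hx j).1, (hx j).2, (hy j).1, (hy j).2]

/-- **`cRep ∘ proj = id` on the centred box** `Λ_M` when `2M < L`. [folklore] -/
theorem Torus.cRep_proj_of_mem_box {M : ℕ} (hML : 2 * M < L) {x : Site d} (hx : x ∈ box d M) :
    Torus.cRep (Torus.proj L x) = x := by
  funext i
  have hxi : |x i| ≤ M := by
    rw [mem_box] at hx
    exact abs_le.2 ⟨(hx i).1, (hx i).2⟩
  rcases Torus.sub_repr_dichotomy (L := L) (z := Torus.cRep (Torus.proj L x) i) (w := x i)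
    (by rw [Torus.cRep, Torus.intCast_cRepZ, Torus.proj_apply]) with h | h
  · exact h
  · exfalso
    have h2 : |Torus.cRep (Torus.proj L x) i - x i| ≤ |Torus.cRep (Torus.proj L x) i| + |x i| := abs_sub _ _
    have h3 : 2 * |Torus.cRep (Torus.proj L x) i| ≤ L := by
      rw [Torus.cRep, Int.abs_eq_natAbs]
      exact_mod_cast Torus.two_mul_natAbs_cRepZ_le (Torus.proj L x i)
    have h4 : (2 * M : ℤ) < L := by exact_mod_cast hML
    linarith

omit [NeZero L] in
/-- `Torus.proj` of a lattice unit vector is the torus unit vector (the `m = 1` case of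
`Torus.proj_single` of `TwoPointLogConvex.lean`, not imported here). [folklore] -/
private theorem Torus.proj_single_one (i : Fin d) : Torus.proj L (Pi.single i (1 : ℤ)) = (Pi.single i 1 : TorusSite d L) := by
  funext j
  rw [Torus.proj_apply]
  rcases eq_or_ne j i with rfl | hj
  · simp
  · simp [Pi.single_eq_of_ne hj]

omit [NeZero L] in
/-- `Torus.proj` is additive (a private copy of `Torus.proj_add` of `TwoPointLogConvex.lean`, not
imported here). [folklore] -/
private theorem Torus.proj_add' (x y : Site d) : Torus.proj L (x + y) = Torus.proj L x + Torus.proj L y := by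
  funext i
  simp [Torus.proj]

omit [NeZero L] in
/-- **The local graph isomorphism**: for `x, y` in the centred box `Λ_M` with `2M + 1 < L`,
`proj x ∼ proj y` in the torus `(ℤ/Lℤ)^d` iff `x ∼ y` in `ℤ^d` (no wrap-around bond is seen).
[cite: FriedliVelenik2017, §3.1] -/
theorem torusGraph_adj_proj_iff_of_mem_box {M : ℕ} (hML : 2 * M + 1 < L) {x y : Site d}
    (hx : x ∈ box d M) (hy : y ∈ box d M) :
    (torusGraph d L).Adj (Torus.proj L x) (Torus.proj L y) ↔ (zdGraph d).Adj x y := by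
  -- `proj y = proj x + eᵢ ↔ y = x + eᵢ` for `x, y ∈ Λ_M`
  have key : ∀ {x y : Site d}, x ∈ box d M → y ∈ box d M → ∀ i : Fin d,
      (Torus.proj L y = Torus.proj L x + Pi.single i 1 ↔ y = x + Pi.single i 1) := by
    intro x y hx hy i
    rw [← Torus.proj_single_one, ← Torus.proj_add']
    refine ⟨fun h => Torus.proj_injective_of_abs_sub_lt (fun j => ?_) h, fun h => by rw [h]⟩
    have h1 := abs_sub_le_two_mul_of_mem_box hy hx j
    have h2 : |(Pi.single i (1 : ℤ) : Site d) j| ≤ 1 := by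
      rcases eq_or_ne j i with rfl | hj
      · simp
      · simp [Pi.single_eq_of_ne hj]
    have h3 : (2 * M + 1 : ℤ) < L := by exact_mod_cast hML
    have h4 : y j - (x + Pi.single i 1 : Site d) j = (y j - x j) - (Pi.single i (1 : ℤ) : Site d) j := by
      rw [Pi.add_apply, sub_add_eq_sub_sub]
    rw [h4]
    exact (abs_sub _ _).trans_lt (by linarith)
  have hne : Torus.proj L x ≠ Torus.proj L y ↔ x ≠ y := by
    refine not_congr ⟨fun h => Torus.proj_injective_of_abs_sub_lt (fun j => ?_) h, fun h => by rw [h]⟩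
    have h1 := abs_sub_le_two_mul_of_mem_box hx hy j
    have h3 : (2 * M + 1 : ℤ) < L := by exact_mod_cast hML
    linarith
  rw [torusGraph_adj_iff, zdGraph_adj_iff, hne]
  constructor
  · rintro ⟨-, ⟨i, hi⟩ | ⟨i, hi⟩⟩
    · exact ⟨i, Or.inl ((key hx hy i).1 hi)⟩
    · exact ⟨i, Or.inr ((key hy hx i).1 hi)⟩
  · rintro ⟨i, h | h⟩
    · refine ⟨fun hxy => ?_, Or.inl ⟨i, (key hx hy i).2 h⟩⟩
      subst hxy
      simpa using congrFun h i
    · refine ⟨fun hxy => ?_, Or.inr ⟨i, (key hy hx i).2 h⟩⟩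
      subst hxy
      simpa using congrFun h i

end Centred

end Literature.Probability.LatticeModels

end
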